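import Mathlib.Analysis.InnerProductSpace.Spectrum
import HarnessLib

/-!
# Courant–Fischer trial-subspace bounds and Weyl's perturbation inequality for the sorted
# eigenvalues of a symmetric operator (finite dimension, real or complex scalars)

Topic `Literature/Analysis/InnerProduct` (next to `KyFanOrthonormal`, `KyFanTwoSmallest`). For a
symmetric operator `T` on a finite-dimensional inner product space `E` over `𝕜 = ℝ` or `ℂ`, with
Mathlib's antitone enumeration `λ = hT.eigenvalues hn : Fin n → ℝ` (`λ₀ ≥ λ₁ ≥ ⋯ ≥ λ_{n-1}`) and
orthonormal eigenvector basis `b = hT.eigenvectorBasis hn`: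

* `re_inner_apply_self_eq_sum` — `re ⟪T x, x⟫ = Σᵢ λᵢ ‖⟪bᵢ, x⟫‖²`; `finrank_tailSpan` /
  `finrank_headSpan` — `dim span {b_k,…,b_{n-1}} = n − k`, `dim span {b₀,…,b_k} = k + 1`;
* one-sided Rayleigh bounds `re_inner_apply_self_le_of_inner_eq_zero` (`x ⊥ b₀,…,b_{k-1}` gives
  `re ⟪T x, x⟫ ≤ λ_k ‖x‖²`) and `le_re_inner_apply_self_of_inner_eq_zero` (`x ⊥ b_{k+1},…` gives
  `λ_k ‖x‖² ≤ re ⟪T x, x⟫`);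
* the two TRIAL-SUBSPACE halves of the Courant–Fischer min–max theorem in existence form
  (Horn–Johnson, *Matrix Analysis*, 2nd ed., Thm. 4.2.6, (4.2.7)–(4.2.8)): every subspace `W` with
  `dim W ≥ n − k` contains `x ≠ 0` with `λ_k ‖x‖² ≤ re ⟪T x, x⟫`
  (`exists_mem_eigenvalues_mul_le_re_inner`), and every subspace with `dim W ≥ k + 1` contains
  `x ≠ 0` with `re ⟪T x, x⟫ ≤ λ_k ‖x‖²` (`exists_mem_re_inner_le_eigenvalues_mul`) — so that
  `λ_k = min_{dim W = n-k} max_W R_T = max_{dim W = k+1} min_W R_T`, the extrema being attained on the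
  spans of eigenvectors (the one-sided Rayleigh bounds);
* WEYL'S PERTURBATION INEQUALITIES (Horn–Johnson Thm. 4.3.1 / Cor. 4.3.15): if
  `re ⟪(S − T) x, x⟫ ≤ c ‖x‖²` for all `x` then `λ_k(S) ≤ λ_k(T) + c`
  (`eigenvalues_le_eigenvalues_add_of_re_inner_sub_le`), the lower companion, and the Lipschitz bound
  `|λ_k(S) − λ_k(T)| ≤ c` under `|re ⟪(S − T) x, x⟫| ≤ c ‖x‖²` (`abs_eigenvalues_sub_eigenvalues_le`).

Everything is proved from Mathlib's spectral theorem (`LinearMap.IsSymmetric.eigenvectorBasis`,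
`apply_eigenvectorBasis`, `eigenvalues_antitone`) and the dimension formula
`Submodule.finrank_sup_add_finrank_inf_eq`. No definitions, no named facts. Mathlib (searched
`Courant`, `minmax`, `Weyl`, `eigenvalues₀_le`) has the extreme eigenvalues only
(`LinearMap.IsSymmetric.hasEigenvalue_iSup_of_finiteDimensional`); the tree had the `n = 3`
middle-eigenvalue case over `ℝ` (`Literature.Analysis.FluidPDE.eigenvalues_mid_le_iff`).

## References

* R. A. Horn, C. R. Johnson, *Matrix Analysis*, 2nd ed., CUP (2013), Thm. 4.2.6 (Courant–Fischer),
  Thm. 4.3.1 and Cor. 4.3.15 (Weyl). [HornJohnson2013]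
* H. Weyl, *Das asymptotische Verteilungsgesetz der Eigenwerte linearer partieller
  Differentialgleichungen*, Math. Ann. 71 (1912) 441–479.
-/

noncomputable section

open scoped InnerProductSpace ComplexConjugate
open Module Finset

namespace Literature.Analysis.InnerProduct

variable {𝕜 : Type*} [RCLike 𝕜] {E : Type*} [NormedAddCommGroup E] [InnerProductSpace 𝕜 E]
  [FiniteDimensional 𝕜 E] {T S : E →ₗ[𝕜] E} {n : ℕ}

/-! ### The quadratic form in eigen-coordinates and one-sided Rayleigh bounds -/

/-- `re ⟪T x, x⟫ = Σᵢ λᵢ ‖⟪bᵢ, x⟫‖²` in the orthonormal eigenvector basis of a symmetric `T`.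
[folklore] -/
theorem re_inner_apply_self_eq_sum (hT : T.IsSymmetric) (hn : finrank 𝕜 E = n) (x : E) :
    RCLike.re ⟪T x, x⟫_𝕜 =
      ∑ i, hT.eigenvalues hn i * ‖⟪hT.eigenvectorBasis hn i, x⟫_𝕜‖ ^ 2 := by
  have h : ⟪T x, x⟫_𝕜 =
      ∑ i, ((hT.eigenvalues hn i : ℝ) : 𝕜) * ((‖⟪hT.eigenvectorBasis hn i, x⟫_𝕜‖ : 𝕜) ^ 2) := by
    rw [← (hT.eigenvectorBasis hn).sum_inner_mul_inner (T x) x]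
    refine Finset.sum_congr rfl fun i _ => ?_
    rw [hT x (hT.eigenvectorBasis hn i), hT.apply_eigenvectorBasis, inner_smul_right,
      ← inner_conj_symm x (hT.eigenvectorBasis hn i), mul_assoc, RCLike.conj_mul]
  rw [h, map_sum]
  refine Finset.sum_congr rfl fun i _ => ?_
  rw [← RCLike.ofReal_pow, ← RCLike.ofReal_mul, RCLike.ofReal_re]

/-- Parseval in the eigenvector basis: `‖x‖² = Σᵢ ‖⟪bᵢ, x⟫‖²`. [folklore] -/
theorem norm_sq_eq_sum_eigenvectorBasis (hT : T.IsSymmetric) (hn : finrank 𝕜 E = n) (x : E) :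
    ‖x‖ ^ 2 = ∑ i, ‖⟪hT.eigenvectorBasis hn i, x⟫_𝕜‖ ^ 2 := by
  rw [← (hT.eigenvectorBasis hn).sum_sq_norm_inner_right x]

/-- **Upper one-sided Rayleigh bound.** If `x` is orthogonal to the eigenvectors `b₀, …, b_{k-1}`
of the `k` largest eigenvalues, then `re ⟪T x, x⟫ ≤ λ_k ‖x‖²` (the maximum of the Rayleigh quotient
over `span {b_k, …, b_{n-1}}` is `λ_k`: the attained case of the min–max (4.2.7)).
[cite: HornJohnson2013, Thm 4.2.6] -/
theorem re_inner_apply_self_le_of_inner_eq_zero (hT : T.IsSymmetric) (hn : finrank 𝕜 E = n)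
    (k : Fin n) {x : E} (hx : ∀ i : Fin n, i < k → ⟪hT.eigenvectorBasis hn i, x⟫_𝕜 = 0) :
    RCLike.re ⟪T x, x⟫_𝕜 ≤ hT.eigenvalues hn k * ‖x‖ ^ 2 := by
  rw [re_inner_apply_self_eq_sum hT hn x, norm_sq_eq_sum_eigenvectorBasis hT hn x, Finset.mul_sum]
  refine Finset.sum_le_sum fun i _ => ?_
  by_cases hi : i < k
  · rw [hx i hi]
    simp
  · exact mul_le_mul_of_nonneg_right (hT.eigenvalues_antitone hn (not_lt.mp hi)) (sq_nonneg _)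

/-- **Lower one-sided Rayleigh bound.** If `x` is orthogonal to the eigenvectors `b_{k+1}, …,
b_{n-1}` of the `n − k − 1` smallest eigenvalues, then `λ_k ‖x‖² ≤ re ⟪T x, x⟫` (the minimum of the
Rayleigh quotient over `span {b₀, …, b_k}` is `λ_k`: the attained case of the max–min (4.2.8)).
[cite: HornJohnson2013, Thm 4.2.6] -/
theorem le_re_inner_apply_self_of_inner_eq_zero (hT : T.IsSymmetric) (hn : finrank 𝕜 E = n)
    (k : Fin n) {x : E} (hx : ∀ i : Fin n, k < i → ⟪hT.eigenvectorBasis hn i, x⟫_𝕜 = 0) :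
    hT.eigenvalues hn k * ‖x‖ ^ 2 ≤ RCLike.re ⟪T x, x⟫_𝕜 := by
  rw [re_inner_apply_self_eq_sum hT hn x, norm_sq_eq_sum_eigenvectorBasis hT hn x, Finset.mul_sum]
  refine Finset.sum_le_sum fun i _ => ?_
  by_cases hi : k < i
  · rw [hx i hi]
    simp
  · exact mul_le_mul_of_nonneg_right (hT.eigenvalues_antitone hn (not_lt.mp hi)) (sq_nonneg _)

/-! ### Spans of heads and tails of the eigenvector basis (`span {b₀,…,b_k}`, `span {b_k,…,b_{n-1}}`) -/

/-- `dim span {b_k, …, b_{n-1}} = n − k`. [folklore] -/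
theorem finrank_tailSpan (hT : T.IsSymmetric) (hn : finrank 𝕜 E = n) (k : Fin n) :
    finrank 𝕜 (Submodule.span 𝕜 (Set.range fun j : {j : Fin n // k ≤ j} => hT.eigenvectorBasis hn j)) = n - k := by
  have hli : LinearIndependent 𝕜 fun j : {j : Fin n // k ≤ j} => hT.eigenvectorBasis hn j :=
    (hT.eigenvectorBasis hn).orthonormal.linearIndependent.comp
      (fun j : {j : Fin n // k ≤ j} => (j : Fin n)) Subtype.val_injective
  rw [finrank_span_eq_card hli, Fintype.card_subtype]
  have hI : (Finset.univ.filter fun x : Fin n => k ≤ x) = Finset.Ici k := by ext; simp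
  rw [hI, Fin.card_Ici]

/-- `dim span {b₀, …, b_k} = k + 1`. [folklore] -/
theorem finrank_headSpan (hT : T.IsSymmetric) (hn : finrank 𝕜 E = n) (k : Fin n) :
    finrank 𝕜 (Submodule.span 𝕜 (Set.range fun j : {j : Fin n // j ≤ k} => hT.eigenvectorBasis hn j)) = k + 1 := by
  have hli : LinearIndependent 𝕜 fun j : {j : Fin n // j ≤ k} => hT.eigenvectorBasis hn j :=
    (hT.eigenvectorBasis hn).orthonormal.linearIndependent.comp
      (fun j : {j : Fin n // j ≤ k} => (j : Fin n)) Subtype.val_injective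
  rw [finrank_span_eq_card hli, Fintype.card_subtype]
  have hI : (Finset.univ.filter fun x : Fin n => x ≤ k) = Finset.Iic k := by ext; simp
  rw [hI, Fin.card_Iic]

/-- Vectors in `span {b_k, …}` are orthogonal to `b_i`, `i < k`. [folklore] -/
theorem inner_eq_zero_of_mem_tailSpan (hT : T.IsSymmetric) (hn : finrank 𝕜 E = n) (k : Fin n)
    {x : E} (hx : x ∈ Submodule.span 𝕜 (Set.range fun j : {j : Fin n // k ≤ j} => hT.eigenvectorBasis hn j)) (i : Fin n) (hi : i < k) :
    ⟪hT.eigenvectorBasis hn i, x⟫_𝕜 = 0 := by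
  rw [← Submodule.mem_orthogonal_singleton_iff_inner_right]
  refine (Submodule.span_le.2 ?_) hx
  rintro _ ⟨j, rfl⟩
  rw [SetLike.mem_coe, Submodule.mem_orthogonal_singleton_iff_inner_right]
  exact (hT.eigenvectorBasis hn).orthonormal.2 (fun h => (lt_of_lt_of_le hi j.2).ne h)

/-- Vectors in `span {b₀, …, b_k}` are orthogonal to `b_i`, `k < i`. [folklore] -/
theorem inner_eq_zero_of_mem_headSpan (hT : T.IsSymmetric) (hn : finrank 𝕜 E = n) (k : Fin n)
    {x : E} (hx : x ∈ Submodule.span 𝕜 (Set.range fun j : {j : Fin n // j ≤ k} => hT.eigenvectorBasis hn j)) (i : Fin n) (hi : k < i) :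
    ⟪hT.eigenvectorBasis hn i, x⟫_𝕜 = 0 := by
  rw [← Submodule.mem_orthogonal_singleton_iff_inner_right]
  refine (Submodule.span_le.2 ?_) hx
  rintro _ ⟨j, rfl⟩
  rw [SetLike.mem_coe, Submodule.mem_orthogonal_singleton_iff_inner_right]
  exact (hT.eigenvectorBasis hn).orthonormal.2 (fun h => (lt_of_le_of_lt j.2 hi).ne' h)

/-- Dimension count: two subspaces whose dimensions add up to more than `dim E` meet
non-trivially. [folklore] -/
theorem exists_mem_inf_ne_zero_of_finrank_lt (W V : Submodule 𝕜 E)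
    (h : finrank 𝕜 E < finrank 𝕜 W + finrank 𝕜 V) : ∃ x, x ∈ W ∧ x ∈ V ∧ x ≠ 0 := by
  have hsum := Submodule.finrank_sup_add_finrank_inf_eq W V
  have hle : finrank 𝕜 ↥(W ⊔ V) ≤ finrank 𝕜 E := Submodule.finrank_le _
  have hpos : 0 < finrank 𝕜 ↥(W ⊓ V) := by omega
  have hne : W ⊓ V ≠ ⊥ := fun hbot => by
    rw [hbot, finrank_bot] at hpos
    exact lt_irrefl 0 hpos
  obtain ⟨x, hx, hx0⟩ := (Submodule.ne_bot_iff _).1 hne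
  exact ⟨x, hx.1, hx.2, hx0⟩

/-! ### Courant–Fischer: the trial-subspace inequalities -/

/-- **Courant–Fischer, min–max half (trial form).** Every subspace `W` with `dim W ≥ n − k`
contains a non-zero `x` with `λ_k ‖x‖² ≤ re ⟪T x, x⟫`; hence `λ_k ≤ max_W R_T` for every such `W`
and `λ_k = min_{dim W = n−k} max_{x ∈ W} R_T(x)` (Horn–Johnson (4.2.7); `W` meets
`span {b₀, …, b_k}` non-trivially by the dimension count `(n − k) + (k + 1) > n`).
[cite: HornJohnson2013, Thm 4.2.6] -/
theorem exists_mem_eigenvalues_mul_le_re_inner (hT : T.IsSymmetric) (hn : finrank 𝕜 E = n)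
    (k : Fin n) (W : Submodule 𝕜 E) (hW : n ≤ finrank 𝕜 W + k) :
    ∃ x ∈ W, x ≠ 0 ∧ hT.eigenvalues hn k * ‖x‖ ^ 2 ≤ RCLike.re ⟪T x, x⟫_𝕜 := by
  obtain ⟨x, hxW, hxV, hx0⟩ := exists_mem_inf_ne_zero_of_finrank_lt W
    (Submodule.span 𝕜 (Set.range fun j : {j : Fin n // j ≤ k} => hT.eigenvectorBasis hn j)) (by
    rw [finrank_headSpan, hn]; omega)
  exact ⟨x, hxW, hx0, le_re_inner_apply_self_of_inner_eq_zero hT hn k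
    (fun i hi => inner_eq_zero_of_mem_headSpan hT hn k hxV i hi)⟩

/-- **Courant–Fischer, max–min half (trial form).** Every subspace `W` with `dim W ≥ k + 1`
contains a non-zero `x` with `re ⟪T x, x⟫ ≤ λ_k ‖x‖²`; hence `λ_k ≥ min_W R_T` for every such `W`
and `λ_k = max_{dim W = k+1} min_{x ∈ W} R_T(x)` (Horn–Johnson (4.2.8); `W` meets
`span {b_k, …, b_{n-1}}` non-trivially since `(k + 1) + (n − k) > n`). [cite: HornJohnson2013, Thm 4.2.6] -/
theorem exists_mem_re_inner_le_eigenvalues_mul (hT : T.IsSymmetric) (hn : finrank 𝕜 E = n)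
    (k : Fin n) (W : Submodule 𝕜 E) (hW : (k : ℕ) + 1 ≤ finrank 𝕜 W) :
    ∃ x ∈ W, x ≠ 0 ∧ RCLike.re ⟪T x, x⟫_𝕜 ≤ hT.eigenvalues hn k * ‖x‖ ^ 2 := by
  obtain ⟨x, hxW, hxV, hx0⟩ := exists_mem_inf_ne_zero_of_finrank_lt W
    (Submodule.span 𝕜 (Set.range fun j : {j : Fin n // k ≤ j} => hT.eigenvectorBasis hn j)) (by
    rw [finrank_tailSpan, hn]; omega)
  exact ⟨x, hxW, hx0, re_inner_apply_self_le_of_inner_eq_zero hT hn k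
    (fun i hi => inner_eq_zero_of_mem_tailSpan hT hn k hxV i hi)⟩

/-! ### Weyl's perturbation inequalities -/

/-- **Weyl's inequality, upper.** If the quadratic form of `S − T` is at most `c ‖x‖²`, then
`λ_k(S) ≤ λ_k(T) + c` for every `k` (Horn–Johnson Thm. 4.3.1 with `B = S − T`,
`λ_k(A + B) ≤ λ_k(A) + λ_max(B)`): test `S` on `span {b_k(T), …, b_{n-1}(T)}`.
[cite: HornJohnson2013, Thm 4.3.1] -/
theorem eigenvalues_le_eigenvalues_add_of_re_inner_sub_le (hT : T.IsSymmetric)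
    (hS : S.IsSymmetric) (hn : finrank 𝕜 E = n) {c : ℝ}
    (hc : ∀ x : E, RCLike.re ⟪(S - T) x, x⟫_𝕜 ≤ c * ‖x‖ ^ 2) (k : Fin n) :
    hS.eigenvalues hn k ≤ hT.eigenvalues hn k + c := by
  obtain ⟨x, hxW, hx0, hle⟩ := exists_mem_eigenvalues_mul_le_re_inner hS hn k
    (Submodule.span 𝕜 (Set.range fun j : {j : Fin n // k ≤ j} => hT.eigenvectorBasis hn j))
    (by rw [finrank_tailSpan]; omega)
  have hT' : RCLike.re ⟪T x, x⟫_𝕜 ≤ hT.eigenvalues hn k * ‖x‖ ^ 2 :=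
    re_inner_apply_self_le_of_inner_eq_zero hT hn k
      (fun i hi => inner_eq_zero_of_mem_tailSpan hT hn k hxW i hi)
  have hsplit : RCLike.re ⟪S x, x⟫_𝕜 = RCLike.re ⟪T x, x⟫_𝕜 + RCLike.re ⟪(S - T) x, x⟫_𝕜 := by
    rw [← map_add, ← inner_add_left, LinearMap.sub_apply, add_sub_cancel]
  have hx2 : 0 < ‖x‖ ^ 2 := by positivity
  have h : hS.eigenvalues hn k * ‖x‖ ^ 2 ≤ (hT.eigenvalues hn k + c) * ‖x‖ ^ 2 := by
    calc hS.eigenvalues hn k * ‖x‖ ^ 2 ≤ RCLike.re ⟪S x, x⟫_𝕜 := hle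
      _ = RCLike.re ⟪T x, x⟫_𝕜 + RCLike.re ⟪(S - T) x, x⟫_𝕜 := hsplit
      _ ≤ hT.eigenvalues hn k * ‖x‖ ^ 2 + c * ‖x‖ ^ 2 := add_le_add hT' (hc x)
      _ = (hT.eigenvalues hn k + c) * ‖x‖ ^ 2 := by ring
  exact le_of_mul_le_mul_right h hx2

/-- **Weyl's inequality, lower.** If the quadratic form of `S − T` is at least `−c ‖x‖²`, then
`λ_k(T) − c ≤ λ_k(S)` (Horn–Johnson Thm. 4.3.1, `λ_k(A) + λ_min(B) ≤ λ_k(A + B)`): test `S` on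
`span {b₀(T), …, b_k(T)}`. [cite: HornJohnson2013, Thm 4.3.1] -/
theorem eigenvalues_sub_le_eigenvalues_of_le_re_inner_sub (hT : T.IsSymmetric)
    (hS : S.IsSymmetric) (hn : finrank 𝕜 E = n) {c : ℝ}
    (hc : ∀ x : E, -(c * ‖x‖ ^ 2) ≤ RCLike.re ⟪(S - T) x, x⟫_𝕜) (k : Fin n) :
    hT.eigenvalues hn k - c ≤ hS.eigenvalues hn k := by
  obtain ⟨x, hxW, hx0, hle⟩ := exists_mem_re_inner_le_eigenvalues_mul hS hn k
    (Submodule.span 𝕜 (Set.range fun j : {j : Fin n // j ≤ k} => hT.eigenvectorBasis hn j))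
    (by rw [finrank_headSpan])
  have hT' : hT.eigenvalues hn k * ‖x‖ ^ 2 ≤ RCLike.re ⟪T x, x⟫_𝕜 :=
    le_re_inner_apply_self_of_inner_eq_zero hT hn k
      (fun i hi => inner_eq_zero_of_mem_headSpan hT hn k hxW i hi)
  have hsplit : RCLike.re ⟪S x, x⟫_𝕜 = RCLike.re ⟪T x, x⟫_𝕜 + RCLike.re ⟪(S - T) x, x⟫_𝕜 := by
    rw [← map_add, ← inner_add_left, LinearMap.sub_apply, add_sub_cancel]
  have hx2 : 0 < ‖x‖ ^ 2 := by positivity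
  have h : (hT.eigenvalues hn k - c) * ‖x‖ ^ 2 ≤ hS.eigenvalues hn k * ‖x‖ ^ 2 := by
    calc (hT.eigenvalues hn k - c) * ‖x‖ ^ 2
        = hT.eigenvalues hn k * ‖x‖ ^ 2 + -(c * ‖x‖ ^ 2) := by ring
      _ ≤ RCLike.re ⟪T x, x⟫_𝕜 + RCLike.re ⟪(S - T) x, x⟫_𝕜 := add_le_add hT' (hc x)
      _ = RCLike.re ⟪S x, x⟫_𝕜 := hsplit.symm
      _ ≤ hS.eigenvalues hn k * ‖x‖ ^ 2 := hle
  exact le_of_mul_le_mul_right h hx2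

/-- **Weyl's perturbation bound (Lipschitz continuity of the sorted eigenvalues).** If
`|re ⟪(S − T) x, x⟫| ≤ c ‖x‖²` for all `x` (e.g. `‖S − T‖ ≤ c`), then `|λ_k(S) − λ_k(T)| ≤ c` for
every `k`. [cite: HornJohnson2013, Cor 4.3.15] -/
theorem abs_eigenvalues_sub_eigenvalues_le (hT : T.IsSymmetric) (hS : S.IsSymmetric)
    (hn : finrank 𝕜 E = n) {c : ℝ}
    (hc : ∀ x : E, |RCLike.re ⟪(S - T) x, x⟫_𝕜| ≤ c * ‖x‖ ^ 2) (k : Fin n) :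
    |hS.eigenvalues hn k - hT.eigenvalues hn k| ≤ c := by
  rw [abs_le]
  constructor
  · have h := eigenvalues_sub_le_eigenvalues_of_le_re_inner_sub hT hS hn
      (fun x => (abs_le.1 (hc x)).1) k
    linarith
  · have h := eigenvalues_le_eigenvalues_add_of_re_inner_sub_le hT hS hn
      (fun x => (abs_le.1 (hc x)).2) k
    linarith

end Literature.Analysis.InnerProduct

end
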